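import Literature.Computability.Complexity.CarrySaveCounter
import Mathlib.Logic.Equiv.Fin.Basic
import Mathlib.Data.Nat.Bits
import HarnessLib

/-!
# Majority of `2m+1` bits in `≤ 9m + 3` gates over `B₂` (the Demenkov–Kojevnikov–Kulikov–Yaroslavtsev counter)

We assemble the MDFA carry-save levels of
`Literature/Computability/Complexity/CarrySaveCounter.lean` into a `B₂`-circuit computing the
binary representation of `x₀ + ⋯ + x_{2m}` and compare it with `m + 1`:

* level 0: `x₀` is the running bit and the other `2m` inputs are encoded as `m` pairs
  `(x_{2p+1} ⊕ x_{2p+2}, x_{2p+2})` — `m` XOR gates (`cktSize_enc`);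
* the ladder of levels (`cktSize_ladder`): a level with `k = 2a + c` pairs costs `≤ 4k`
  gates and hands `⌊k/2⌋` carry pairs and `k mod 2` lone carries to the next level; the last
  running bit of level `j` is bit `j` of the sum; in total `ladCost + 2·ladBits ≤ 8m + 3`
  (`ladCost_add_le`), where `ladBits` is the number of levels (= output bits);
* an LSB-first comparator with the constant `m + 1` (`cktSize_geFn`, one gate per bit).

**Theorem** (`cktSize_maj`, `circuitSizeOver_maj_le`): `MAJ_{2m+1}` has `B₂`-circuits of size
`≤ 9m + 3 ≤ 4.5(2m+1)`. This is the instance of the `4.5n + o(n)` upper bound of Demenkov,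
Kojevnikov, Kulikov and Yaroslavtsev (IPL 2010) for all symmetric functions — here with the
bookkeeping done so that NO lower-order term remains, which is the form
"the majority of `2m + 1` bits can be computed by a circuit of size `4.5(2m + 1)`" used by
Golovnev–Hirsch–Knop–Kulikov (MFCS 2016, Lemma 1).

Sources: E. Demenkov, A. Kojevnikov, A. S. Kulikov, G. Yaroslavtsev, *New upper bounds on the
Boolean circuit complexity of symmetric functions*, IPL 110 (2010) 264–267; A. S. Kulikov,
D. Pechenev, N. Slezkin, *SAT-based circuit local improvement*, MFCS 2022, §3.1.1 ("Compute
`x₂ ⊕ x₃, x₄ ⊕ x₅, …` (`n/2` gates). Apply at most `n/2` MDFA blocks (no more than `4n`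
gates)"); A. Golovnev, E. A. Hirsch, A. Knop, A. S. Kulikov, *On the limits of gate
elimination*, MFCS 2016, §3.2 (PDF p. 6). The exact constant bookkeeping (`9m + 3`) is ours.
-/

namespace Literature.Computability.Complexity

open Finset GateList

/-! ### Regrouping `2a + c` pairs as `c` odd pairs and `a` pairs of pairs -/

/-- `Fin c ⊕ (Fin a × Bool) ≃ Fin (2a + c)`. [folklore] -/
def rg (c a : ℕ) : Fin c ⊕ (Fin a × Bool) ≃ Fin (2 * a + c) :=
  ((Equiv.refl (Fin c)).sumCongr
    (((Equiv.refl (Fin a)).prodCongr finTwoEquiv.symm).trans finProdFinEquiv)).trans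
    (finSumFinEquiv.trans (finCongr (by omega)))

/-- Reading the tokens of shape `(b, c, a)` off `b` lone bits and `2a + c` encoded pairs. [folklore] -/
def rgIn {b c a : ℕ} : LIn b c a → LUp b (2 * a + c)
  | .inl i => .inl i
  | .inr (.inl (i, cpt)) => .inr (rg c a (.inl i), cpt)
  | .inr (.inr (j, w, cpt)) => .inr (rg c a (.inr (j, w)), cpt)

/-- Regrouping preserves the total value. [folklore] -/
theorem lval_rgIn {b c a : ℕ} (u : LUp b (2 * a + c) → Bool) :
    lval (fun t : LIn b c a => u (rgIn t)) = upVal u := by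
  simp only [lval, upVal, rgIn, ppVal, upPairsVal]
  rw [add_assoc, ← Fintype.sum_equiv (rg c a) (fun q => pairVal (u (.inr (rg c a q, false)))
    (u (.inr (rg c a q, true)))) _ (fun _ => rfl), Fintype.sum_sum_type]

/-! ### The ladder of levels -/

/-- Gate count of one level of shape `(b, c, a)` (`b` lone bits, `c` odd pairs, `a` pairs of
pairs; `b, c ≤ 1`): `8a + 4c` with a lone bit, `8a + 1` / `8(a-1) + 6` without. [folklore] -/
def levelCost (b c a : ℕ) : ℕ :=
  if b = 1 then 8 * a + 4 * c else if c = 1 then 8 * a + 1 else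
    match a with
    | 0 => 0
    | a + 1 => 8 * a + 6

/-- One level of shape `(b, c, a)` exists with the stated gate count and conservation law
(dispatch over the four shapes). [folklore] -/
theorem level_exists (b c a : ℕ) (hb : b ≤ 1) (hc : c ≤ 1) (h : ¬(b = 0 ∧ c = 0 ∧ a = 0)) :
    ∃ L : (LIn b c a → Bool) → Unit ⊕ LUp c a → Bool, CktSize B2 L (levelCost b c a) ∧
      ∀ y, lval y = (L y (.inl ())).toNat + 2 * upVal fun u => L y (.inr u) := by
  have hb' : b = 0 ∨ b = 1 := by omega
  have hc' : c = 0 ∨ c = 1 := by omega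
  rcases hb' with rfl | rfl <;> rcases hc' with rfl | rfl
  · obtain ⟨a, rfl⟩ : ∃ a', a = a' + 1 := ⟨a - 1, by omega⟩
    exact ⟨levelFn₀₀ a, (cktSize_level₀₀ a).of_le (by simp [levelCost]), levelFn₀₀_spec a⟩
  · exact ⟨levelFn₀₁ a, (cktSize_level₀₁ a).of_le (by simp [levelCost]), levelFn₀₁_spec a⟩
  · exact ⟨levelFn₁₀ a, (cktSize_level₁₀ a).of_le (by simp [levelCost]), levelFn₁₀_spec a⟩
  · exact ⟨levelFn₁₁ a, (cktSize_level₁₁ a).of_le (by simp [levelCost]), levelFn₁₁_spec a⟩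

/-- Number of levels (= output bits) of the ladder started at a level with `c` odd pairs and
`a` pairs of pairs: one, plus the levels above fed by its `c` lone carries and `a` carry pairs. [folklore] -/
def ladBits (c a : ℕ) : ℕ :=
  if c = 0 ∧ a = 0 then 1 else ladBits (a % 2) (a / 2) + 1
termination_by 2 * a + c
decreasing_by omega

/-- Gate count of the ladder from shape `(b, c, a)` (including one constant gate at the top). [folklore] -/
def ladCost (b c a : ℕ) : ℕ :=
  if c = 0 ∧ a = 0 then 1 else levelCost b c a + ladCost c (a % 2) (a / 2)
termination_by 2 * a + c
decreasing_by omega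

/-- The top level produces one bit. [folklore] -/
theorem ladBits_base (c a : ℕ) (h : c = 0 ∧ a = 0) : ladBits c a = 1 := by
  rw [ladBits, if_pos h]

/-- Unfolding `ladBits` below the top. [folklore] -/
theorem ladBits_step (c a : ℕ) (h : ¬(c = 0 ∧ a = 0)) :
    ladBits c a = ladBits (a % 2) (a / 2) + 1 := by
  rw [ladBits, if_neg h]

/-- The top level costs one (constant) gate. [folklore] -/
theorem ladCost_base (b c a : ℕ) (h : c = 0 ∧ a = 0) : ladCost b c a = 1 := by
  rw [ladCost, if_pos h]

/-- Unfolding `ladCost` below the top. [folklore] -/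
theorem ladCost_step (b c a : ℕ) (h : ¬(c = 0 ∧ a = 0)) :
    ladCost b c a = levelCost b c a + ladCost c (a % 2) (a / 2) := by
  rw [ladCost, if_neg h]

/-- The ladder always produces at least one bit. [folklore] -/
theorem one_le_ladBits (c a : ℕ) : 1 ≤ ladBits c a := by
  by_cases h : c = 0 ∧ a = 0
  · rw [ladBits_base c a h]
  · rw [ladBits_step c a h]; omega

/-- **Cost of the ladder**: `ladCost + 2 · ladBits ≤ 8k + 2b + 1` for `k = 2a + c` pairs and a
nonempty token set — each level pays `≤ 4` per pair it has, and pairs halve. [folklore] -/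
theorem ladCost_add_le : ∀ (n b c a : ℕ), 2 * a + c < n → b ≤ 1 → c ≤ 1 → 0 < b + c + a →
    ladCost b c a + 2 * ladBits c a ≤ 8 * (2 * a + c) + 2 * b + 1
  | 0, _, _, _, hn, _, _, _ => absurd hn (Nat.not_lt_zero _)
  | n + 1, b, c, a, hn, hb, hc, hv => by
    by_cases h : c = 0 ∧ a = 0
    · rw [ladCost_base b c a h, ladBits_base c a h]; omega
    · rw [ladCost_step b c a h, ladBits_step c a h]
      have ih := ladCost_add_le n c (a % 2) (a / 2) (by omega) hc (by omega) (by omega)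
      have hl : levelCost b c a + 2 ≤ 8 * a + 6 * c + 2 * b := by
        have hb' : b = 0 ∨ b = 1 := by omega
        have hc' : c = 0 ∨ c = 1 := by omega
        rcases hb' with rfl | rfl <;> rcases hc' with rfl | rfl <;> rcases a with _ | a <;>
          simp [levelCost] <;> omega
      omega

/-- `s + 2v` has bit `0` equal to `s` and higher bits those of `v`. [folklore] -/
theorem testBit_toNat_add_two_mul (s : Bool) (v i : ℕ) :
    (s.toNat + 2 * v).testBit i = Nat.rec s (fun j _ => v.testBit j) i := by
  have hb : s.toNat + 2 * v = Nat.bit s v := by rw [Nat.bit_val]; omega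
  rw [hb]
  cases i with
  | zero => exact Nat.testBit_bit_zero s v
  | succ j => exact Nat.testBit_bit_succ j s v

/-- **The ladder computes the bits of the token value**: from tokens of shape `(b, c, a)`
(`b, c ≤ 1`), all bits of `lval` in `ladCost b c a` gates. [cite: KulikovPechenevSlezkin2022, §3.1.1] -/
theorem cktSize_ladder : ∀ (n b c a : ℕ), 2 * a + c < n → b ≤ 1 → c ≤ 1 →
    CktSize B2 (fun (y : LIn b c a → Bool) (i : ℕ) => (lval y).testBit i) (ladCost b c a)
  | 0, _, _, _, hn, _, _ => absurd hn (Nat.not_lt_zero _)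
  | n + 1, b, c, a, hn, hb, hc => by
    by_cases h : c = 0 ∧ a = 0
    · -- top of the ladder: at most one lone bit; bit 0 is it, higher bits are 0
      obtain ⟨rfl, rfl⟩ := h
      rw [ladCost_base b 0 0 ⟨rfl, rfl⟩]
      have h1 : CktSize B2 (fun (y : LIn b 0 0 → Bool) => Sum.elim y fun _ : Unit => false) 1 :=
        (cktSize_const (LIn b 0 0) false).keep
      have hb' : b = 0 ∨ b = 1 := by omega
      rcases hb' with rfl | rfl
      · refine (h1.outMap fun _ : ℕ => Sum.inr ()).congr fun y i => ?_
        simp [lval]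
      · refine (h1.outMap fun i : ℕ => Nat.casesOn i (Sum.inl (Sum.inl 0)) fun _ => Sum.inr ()).congr
          fun y i => ?_
        have hv : lval y = (y (.inl 0)).toNat := by simp [lval]
        rw [hv]
        cases i with
        | zero =>
          show y (.inl 0) = ((y (.inl 0)).toNat).testBit 0
          cases y (.inl 0) <;> rfl
        | succ j =>
          refine (Nat.testBit_lt_two_pow ((Bool.toNat_le _).trans_lt ?_)).symm
          calc (1 : ℕ) < 2 ^ 1 := by omega
            _ ≤ 2 ^ (j + 1) := Nat.pow_le_pow_right (by omega) (by omega)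
    · -- one level, then the ladder above on the regrouped carries
      have hb0 : ¬(b = 0 ∧ c = 0 ∧ a = 0) := fun h' => h ⟨h'.2.1, h'.2.2⟩
      obtain ⟨L, hL, hspec⟩ := level_exists b c a hb hc hb0
      obtain ⟨a₂, c₂, hc₂, rfl⟩ : ∃ a₂ c₂, c₂ ≤ 1 ∧ a = 2 * a₂ + c₂ :=
        ⟨a / 2, a % 2, by omega, by omega⟩
      have hmod : (2 * a₂ + c₂) % 2 = c₂ := by omega
      have hdiv : (2 * a₂ + c₂) / 2 = a₂ := by omega
      rw [ladCost_step b c _ h, hmod, hdiv]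
      have ih := cktSize_ladder n c c₂ a₂ (by omega) hc hc₂
      have h2 : CktSize B2 (fun (z : Unit ⊕ LUp c (2 * a₂ + c₂) → Bool) =>
          Sum.elim (fun i : ℕ => (lval fun t : LIn c c₂ a₂ => z (.inr (rgIn t))).testBit i)
            fun _ : Unit => z (.inl ())) (ladCost c c₂ a₂ + 0) :=
        (ih.rewire fun t => Sum.inr (rgIn t)).pair (CktSize.proj B2 fun _ : Unit => Sum.inl ())
      refine ((hL.comp h2).outMap fun i : ℕ => Nat.casesOn i (Sum.inr ()) fun j => Sum.inl j).congr
        fun y i => ?_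
      rw [hspec y, testBit_toNat_add_two_mul, ← lval_rgIn]
      cases i <;> rfl

/-- The token value is below `2 ^ ladBits`. [folklore] -/
theorem lval_lt : ∀ (n b c a : ℕ), 2 * a + c < n → b ≤ 1 → c ≤ 1 → ∀ y : LIn b c a → Bool,
    lval y < 2 ^ ladBits c a
  | 0, _, _, _, hn, _, _, _ => absurd hn (Nat.not_lt_zero _)
  | n + 1, b, c, a, hn, hb, hc, y => by
    by_cases h : c = 0 ∧ a = 0
    · obtain ⟨rfl, rfl⟩ := h
      rw [ladBits_base 0 0 ⟨rfl, rfl⟩]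
      have : lval y = ∑ i : Fin b, (y (.inl i)).toNat := by simp [lval]
      rw [this]
      have hb' : b = 0 ∨ b = 1 := by omega
      rcases hb' with rfl | rfl
      · simp
      · simp only [Fin.sum_univ_one, pow_one]
        exact (Bool.toNat_le _).trans_lt (by omega)
    · have hb0 : ¬(b = 0 ∧ c = 0 ∧ a = 0) := fun h' => h ⟨h'.2.1, h'.2.2⟩
      obtain ⟨L, -, hspec⟩ := level_exists b c a hb hc hb0
      obtain ⟨a₂, c₂, hc₂, rfl⟩ : ∃ a₂ c₂, c₂ ≤ 1 ∧ a = 2 * a₂ + c₂ :=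
        ⟨a / 2, a % 2, by omega, by omega⟩
      have hmod : (2 * a₂ + c₂) % 2 = c₂ := by omega
      have hdiv : (2 * a₂ + c₂) / 2 = a₂ := by omega
      rw [ladBits_step c _ h, hmod, hdiv, hspec y, ← lval_rgIn, pow_succ]
      have ih := lval_lt n c c₂ a₂ (by omega) hc hc₂ fun t => L y (.inr (rgIn t))
      have hs := Bool.toNat_le (L y (.inl ()))
      omega

/-! ### Level 0: encoding the inputs -/

/-- Input positions: `m` pairs and one extra bit, `(Fin m × Bool) ⊕ Fin 1 ≃ Fin (2m + 1)`. [folklore] -/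
def ix (m : ℕ) : (Fin m × Bool) ⊕ Fin 1 ≃ Fin (2 * m + 1) :=
  ((((Equiv.refl (Fin m)).prodCongr finTwoEquiv.symm).trans finProdFinEquiv).sumCongr
    (Equiv.refl (Fin 1))).trans (finSumFinEquiv.trans (finCongr (by omega)))

/-- Level-0 tokens of `2m + 1` input bits: the extra bit is the lone running bit, pair `p` is
encoded as `(u ⊕ v, v)`. [cite: KulikovPechenevSlezkin2022, §3.1.1] -/
def enc₀ (m : ℕ) (x : Fin (2 * m + 1) → Bool) : LUp 1 m → Bool
  | .inl _ => x (ix m (.inr 0))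
  | .inr (p, false) => xor (x (ix m (.inl (p, false)))) (x (ix m (.inl (p, true))))
  | .inr (p, true) => x (ix m (.inl (p, true)))

/-- The level-0 tokens are worth the number of ones of the input. [folklore] -/
theorem upVal_enc₀ (m : ℕ) (x : Fin (2 * m + 1) → Bool) :
    upVal (enc₀ m x) = ∑ i, (x i).toNat := by
  rw [← Fintype.sum_equiv (ix m) (fun q => (x (ix m q)).toNat) _ (fun _ => rfl),
    Fintype.sum_sum_type, Fintype.sum_prod_type]
  simp only [upVal, upPairsVal, enc₀, pairVal_xor, Fin.sum_univ_one, Fintype.sum_bool]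
  rw [add_comm]
  refine congrArg₂ (· + ·) (Finset.sum_congr rfl fun p _ => add_comm _ _) rfl

/-- **Level 0 costs `m` gates** (the `m` encoding XORs); output already regrouped into shape
`(1, c, a)` with `2a + c = m`. [cite: KulikovPechenevSlezkin2022, §3.1.1] -/
theorem cktSize_enc (c a : ℕ) :
    CktSize B2 (fun (x : Fin (2 * (2 * a + c) + 1) → Bool) (t : LIn 1 c a) =>
      enc₀ (2 * a + c) x (rgIn t)) (2 * a + c) := by
  have h1 : CktSize B2 (fun (x : Fin (2 * (2 * a + c) + 1) → Bool) (p : Fin (2 * a + c)) =>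
      xor (x (ix (2 * a + c) (.inl (p, false)))) (x (ix (2 * a + c) (.inl (p, true)))))
      (Fintype.card (Fin (2 * a + c)) * 1) :=
    CktSize.pi_const fun p => cktSize_bin xor _ _
  rw [Fintype.card_fin, mul_one] at h1
  have h2 := (CktSize.id B2).pair h1
  rw [zero_add] at h2
  refine (h2.outMap fun t : LIn 1 c a => match rgIn t with
    | .inl _ => Sum.inl (ix (2 * a + c) (.inr 0))
    | .inr (p, false) => Sum.inr p
    | .inr (p, true) => Sum.inl (ix (2 * a + c) (.inl (p, true)))).congr fun x t => ?_
  rcases ht : (rgIn t : LUp 1 (2 * a + c)) with _ | ⟨p, _ | _⟩ <;> simp [enc₀]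

/-! ### The comparator with a constant -/

/-- LSB-first comparison of the bits `s₀ … s_{L-1}` with the constant `t`:
`geFn t L s ↔ t mod 2^L ≤ Σ_{i<L} sᵢ 2ⁱ`. [folklore] -/
def geFn (t : ℕ) : ℕ → (ℕ → Bool) → Bool
  | 0, _ => true
  | L + 1, s => if t.testBit L then s L && geFn t L s else s L || geFn t L s

/-- The comparator and its input bits: `L + 1` gates (a constant `true` and one gate per bit). [folklore] -/
theorem cktSize_geFn_keep (t : ℕ) : ∀ L : ℕ,
    CktSize B2 (fun (s : ℕ → Bool) => Sum.elim s fun _ : Unit => geFn t L s) (L + 1)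
  | 0 => (cktSize_const ℕ true).keep
  | L + 1 => by
    refine (((cktSize_geFn_keep t L).andThen (fun a g => if t.testBit L then a && g else a || g)
      (.inl L) (.inr ())).outMap (Sum.elim (fun i => Sum.inl (Sum.inl i)) fun _ => Sum.inr ())).congr
      fun s o => ?_
    rcases o with i | _
    · rfl
    · simp only [Sum.elim_inr, Sum.elim_inl, geFn]

/-- Semantics of the comparator on the bits of `v`. [folklore] -/
theorem geFn_testBit (t v : ℕ) : ∀ L : ℕ,
    geFn t L (fun i => v.testBit i) = decide (t % 2 ^ L ≤ v % 2 ^ L)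
  | 0 => by simp [geFn, Nat.mod_one]
  | L + 1 => by
    rw [geFn, geFn_testBit t v L, Nat.mod_pow_succ, Nat.mod_pow_succ, ← Nat.toNat_testBit,
      ← Nat.toNat_testBit]
    have h1 := Nat.mod_lt t (Nat.two_pow_pos L)
    have h2 := Nat.mod_lt v (Nat.two_pow_pos L)
    cases t.testBit L <;> cases v.testBit L <;> simp <;> omega

/-! ### The majority circuit -/

/-- The number of ones is the sum of the bits. [folklore] -/
theorem numOnes_eq_sum {k : ℕ} (x : Fin k → Bool) : GateFn.numOnes x = ∑ i, (x i).toNat := by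
  rw [GateFn.numOnes, Finset.card_filter]
  exact Finset.sum_congr rfl fun i _ => by cases x i <;> rfl

/-- **`MAJ_{2m+1}` in `9m + 3` gates over `B₂`** (Demenkov–Kojevnikov–Kulikov–Yaroslavtsev:
`m` encoding XORs, `≤ 8m + 3 - 2·levels` gates of MDFA levels, `levels + 1` comparator gates). [cite: KulikovPechenevSlezkin2022, §3.1.1] -/
theorem cktSize_maj (m : ℕ) :
    CktSize B2 (fun (x : Fin (2 * m + 1) → Bool) (_ : Unit) => (GateFn.maj (2 * m + 1)).2 x)
      (9 * m + 3) := by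
  obtain ⟨a, c, hc, rfl⟩ : ∃ a c, c ≤ 1 ∧ m = 2 * a + c := ⟨m / 2, m % 2, by omega, by omega⟩
  set L := ladBits c a with hL
  -- the three stages
  have hE := cktSize_enc c a
  have hLad := cktSize_ladder (2 * a + c + 1) 1 c a (by omega) le_rfl hc
  have hG := (cktSize_geFn_keep (2 * a + c + 1) L).outMap fun _ : Unit => Sum.inr ()
  have hcost := ladCost_add_le (2 * a + c + 1) 1 c a (by omega) le_rfl hc (by omega)
  have hL1 : 1 ≤ L := one_le_ladBits c a
  refine (((hE.comp hLad).comp hG).of_le (by omega)).congr fun x u => ?_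
  -- semantics
  have hv : lval (fun t : LIn 1 c a => enc₀ (2 * a + c) x (rgIn t)) = GateFn.numOnes x := by
    rw [lval_rgIn, upVal_enc₀, numOnes_eq_sum]
  have hlt : GateFn.numOnes x < 2 ^ L :=
    hv ▸ lval_lt (2 * a + c + 1) 1 c a (by omega) le_rfl hc _
  have hlt1 : 2 * (2 * a + c) + 1 < 2 ^ L := by
    have h := lval_lt (2 * a + c + 1) 1 c a (by omega) le_rfl hc
      fun t : LIn 1 c a => enc₀ (2 * a + c) (fun _ => true) (rgIn t)
    rwa [lval_rgIn, upVal_enc₀, Finset.sum_const, Finset.card_univ, Fintype.card_fin,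
      smul_eq_mul, Bool.toNat_true, mul_one] at h
  simp only [Sum.elim_inr]
  rw [hv, geFn_testBit, Nat.mod_eq_of_lt hlt, Nat.mod_eq_of_lt (by omega)]
  simp only [GateFn.maj]
  by_cases hm : 2 * a + c + 1 ≤ GateFn.numOnes x
  · rw [decide_eq_true hm, decide_eq_true (by omega)]
  · rw [decide_eq_false hm, decide_eq_false (by omega)]

/-- **`gates_{B₂}(MAJ_{2m+1}) ≤ 9m + 3 ≤ 4.5 (2m+1)`.** [cite: KulikovPechenevSlezkin2022, §3.1.1] -/
theorem circuitSizeOver_maj_le (m : ℕ) :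
    circuitSizeOver B2 (GateFn.maj (2 * m + 1)).2 ≤ 9 * m + 3 := by
  obtain ⟨C, hB, hs, hC⟩ := (cktSize_maj m).toCircuit
  exact (circuitSizeOver_le_of_computes C hB fun x => hC x).trans hs

end Literature.Computability.Complexity
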